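import Summits.ABC.StewartYu.KappaDoor
import Summits.ABC.StewartYu.GluePrincipalToPrime
import Literature.Barriers.ABC.BakerMethodBoundsEpsShape
import HarnessLib

/-!
# Cell abc-stewartyu, the κ-door onto the tree's named `ε`-shape, and the M1⁺ composition

`Summits/ABC/StewartYu/KappaDoorEpsShape.lean` — cell `abc-stewartyu` (HOME
`run/shared/lean/pub/abc-stewartyu/`, seat p3; theorems only, no named fact).  With
`Literature.Barriers.ABC.EpsShapeBound` now a tree definition (`BakerMethodBoundsEpsShape.lean`),
the κ-door `KappaDoor.epsShape_of_oddFinBound` concludes it BY NAME: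

* `KappaDoor.epsShapeBound_of_oddFinBound` — the one-prime bound `FinBoundAt p K L κ σ τ τ₁` at every
  odd prime (`K ≥ 0`, `L ≥ 1`, `0 ≤ σ ≤ 2`, any real `κ`) gives `EpsShapeBound (max 1 κ)`;
* `KappaDoor.epsShapeBound_of_principal_core` — WP-M (principal generators) and ANY Theorem-A-shaped
  bound with envelope `C(m) ≤ c₁^m m^{c₂ m}` give `EpsShapeBound (max 1 (c₂ + 2))` (the glue
  `primePadicBoundAt_odd_of_principal`: `K = 4704`, `L = 32c₁`, `κ = c₂ + 2`, `σ = τ = τ₁ = 2`);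
* `KappaDoor.epsShapeBoundFour_of_principal_core` — with `c₂ ≤ 2` this is the rung
  `EpsShapeBoundFour` (`log c ≪_ε rad^{4+ε}`), and `KappaDoor.epsShapeBoundThree_of_principal_core` —
  with `c₂ ≤ 1` the rung `EpsShapeBoundThree`.

Everything is [folklore].
-/

noncomputable section

open Finset
open Literature.NumberTheory.DiophantineGeometry
open Literature.Barriers.ABC

namespace Summit.ABC.StewartYu

namespace KappaDoor

/-- **The κ-door onto the named `ε`-shape**: the one-prime bound at every odd prime with exponent `κ`
on `n^{κn}` and `p^σ`, `σ ≤ 2`, gives `log c ≪_ε rad(abc)^{max(1,κ)+ε}`. [folklore] -/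
theorem epsShapeBound_of_oddFinBound {K L κ σ : ℝ} {τ τ₁ : ℕ} (hK : 0 ≤ K) (hL : 1 ≤ L)
    (hσ0 : 0 ≤ σ) (hσ : σ ≤ 2) (hP : ∀ p : ℕ, p.Prime → p ≠ 2 → FinBoundAt p K L κ σ τ τ₁) :
    EpsShapeBound (max 1 κ) :=
  fun ε hε => epsShape_of_oddFinBound hK hL hσ0 hσ hP ε hε

/-- **M1⁺ composition**: WP-M and a Theorem-A-shaped bound with envelope `C(m) ≤ c₁^m m^{c₂ m}` give
`EpsShapeBound (max 1 (c₂ + 2))`. [folklore] -/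
theorem epsShapeBound_of_principal_core
    (hM : ∀ (p : ℕ), p.Prime → p ≠ 2 → ∀ (m : ℕ) (q : Fin m → ℕ),
      (∀ i, (q i).Prime) → Function.Injective q → (∀ i, q i ≠ p) →
      ∀ (e : Fin m → ℤ), e ≠ 0 → 1 ≤ padicValRat p (∏ i, (q i : ℚ) ^ e i - 1) →
      ∃ (α : Fin m → ℚ) (e' : Fin m → ℤ),
        (∀ j, α j ≠ 0 ∧ 1 ≤ padicValRat p (α j - 1)) ∧
        (∀ μ : Fin m → ℤ, ∏ j, α j ^ μ j = 1 → μ = 0) ∧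
        (∀ T : Finset (Fin m), T.Nonempty → ¬ IsSquare (∏ j ∈ T, α j)) ∧
        e' ≠ 0 ∧ ∏ i, (q i : ℚ) ^ e i = ∏ j, α j ^ e' j ∧
        (∏ j, Height.logHeight₁ (α j)) ≤ (m : ℝ) ^ (2 * m) * p * ∏ i, Real.log (q i) ∧
        (∀ j, (|e' j| : ℝ) ≤
          (m : ℝ) ^ (2 * m) * p * (∏ i, Real.log (q i)) * (Finset.univ.sup fun i => (e i).natAbs)) ∧
        (∀ j, Real.log p ≤ 2 * Height.logHeight₁ (α j)))
    {C : ℕ → ℝ} {r : ℕ → ℕ} {c₁ c₂ : ℝ} (hc₁ : 1 ≤ c₁)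
    (hC : ∀ m, 0 ≤ C m ∧ C m ≤ c₁ ^ m * (m : ℝ) ^ (c₂ * m))
    (hA : ∀ (p : ℕ), p.Prime → p ≠ 2 →
      ∀ (m : ℕ) (α : Fin m → ℚ) (b : Fin m → ℤ) (V : Fin m → ℝ) (Vmax W : ℝ),
        (∀ j, α j ≠ 0 ∧ 1 ≤ padicValRat p (α j - 1)) →
        (∀ μ : Fin m → ℤ, ∏ j, α j ^ μ j = 1 → μ = 0) →
        (∀ T : Finset (Fin m), T.Nonempty → ¬ IsSquare (∏ j ∈ T, α j)) →
        (∀ j, Height.logHeight₁ (α j) ≤ V j) → (∀ j, Real.log p ≤ V j) → (∀ j, V j ≤ Vmax) →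
        b ≠ 0 → (∀ j, Real.log (max 3 (|b j| : ℝ)) ≤ W) →
        (padicValRat p (∏ j, α j ^ b j - 1) : ℝ) * Real.log p ≤
          C m * (∏ j, V j) * (W + Real.log (2 * Vmax)) * Real.log (2 * Vmax) / Real.log p ^ r m) :
    EpsShapeBound (max 1 (c₂ + 2)) := by
  refine epsShapeBound_of_oddFinBound (K := 4704) (L := 32 * c₁) (σ := 2) (τ := 2) (τ₁ := 2)
    (by norm_num) (by linarith) (by norm_num) le_rfl ?_
  intro p hp hp2 n q e hq hinj hqp he hne1
  exact primePadicBoundAt_odd_of_principal hM hc₁ hC hA hp hp2 n q e hq hinj hqp he hne1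

/-- **The rung `rad^{4+ε}`** from WP-M and a Theorem-A-shaped bound with `c₂ ≤ 2`. [folklore] -/
theorem epsShapeBoundFour_of_principal_core
    (hM : ∀ (p : ℕ), p.Prime → p ≠ 2 → ∀ (m : ℕ) (q : Fin m → ℕ),
      (∀ i, (q i).Prime) → Function.Injective q → (∀ i, q i ≠ p) →
      ∀ (e : Fin m → ℤ), e ≠ 0 → 1 ≤ padicValRat p (∏ i, (q i : ℚ) ^ e i - 1) →
      ∃ (α : Fin m → ℚ) (e' : Fin m → ℤ),
        (∀ j, α j ≠ 0 ∧ 1 ≤ padicValRat p (α j - 1)) ∧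
        (∀ μ : Fin m → ℤ, ∏ j, α j ^ μ j = 1 → μ = 0) ∧
        (∀ T : Finset (Fin m), T.Nonempty → ¬ IsSquare (∏ j ∈ T, α j)) ∧
        e' ≠ 0 ∧ ∏ i, (q i : ℚ) ^ e i = ∏ j, α j ^ e' j ∧
        (∏ j, Height.logHeight₁ (α j)) ≤ (m : ℝ) ^ (2 * m) * p * ∏ i, Real.log (q i) ∧
        (∀ j, (|e' j| : ℝ) ≤
          (m : ℝ) ^ (2 * m) * p * (∏ i, Real.log (q i)) * (Finset.univ.sup fun i => (e i).natAbs)) ∧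
        (∀ j, Real.log p ≤ 2 * Height.logHeight₁ (α j)))
    {C : ℕ → ℝ} {r : ℕ → ℕ} {c₁ c₂ : ℝ} (hc₁ : 1 ≤ c₁) (hc₂ : c₂ ≤ 2)
    (hC : ∀ m, 0 ≤ C m ∧ C m ≤ c₁ ^ m * (m : ℝ) ^ (c₂ * m))
    (hA : ∀ (p : ℕ), p.Prime → p ≠ 2 →
      ∀ (m : ℕ) (α : Fin m → ℚ) (b : Fin m → ℤ) (V : Fin m → ℝ) (Vmax W : ℝ),
        (∀ j, α j ≠ 0 ∧ 1 ≤ padicValRat p (α j - 1)) →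
        (∀ μ : Fin m → ℤ, ∏ j, α j ^ μ j = 1 → μ = 0) →
        (∀ T : Finset (Fin m), T.Nonempty → ¬ IsSquare (∏ j ∈ T, α j)) →
        (∀ j, Height.logHeight₁ (α j) ≤ V j) → (∀ j, Real.log p ≤ V j) → (∀ j, V j ≤ Vmax) →
        b ≠ 0 → (∀ j, Real.log (max 3 (|b j| : ℝ)) ≤ W) →
        (padicValRat p (∏ j, α j ^ b j - 1) : ℝ) * Real.log p ≤
          C m * (∏ j, V j) * (W + Real.log (2 * Vmax)) * Real.log (2 * Vmax) / Real.log p ^ r m) :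
    EpsShapeBoundFour := by
  rw [epsShapeBoundFour_iff]
  refine epsShapeBound_mono ?_ (epsShapeBound_of_principal_core hM hc₁ hC hA)
  exact max_le (by norm_num) (by linarith)

/-- **The rung `rad^{3+ε}`** from WP-M and a Theorem-A-shaped bound with `c₂ ≤ 1`. [folklore] -/
theorem epsShapeBoundThree_of_principal_core
    (hM : ∀ (p : ℕ), p.Prime → p ≠ 2 → ∀ (m : ℕ) (q : Fin m → ℕ),
      (∀ i, (q i).Prime) → Function.Injective q → (∀ i, q i ≠ p) →
      ∀ (e : Fin m → ℤ), e ≠ 0 → 1 ≤ padicValRat p (∏ i, (q i : ℚ) ^ e i - 1) →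
      ∃ (α : Fin m → ℚ) (e' : Fin m → ℤ),
        (∀ j, α j ≠ 0 ∧ 1 ≤ padicValRat p (α j - 1)) ∧
        (∀ μ : Fin m → ℤ, ∏ j, α j ^ μ j = 1 → μ = 0) ∧
        (∀ T : Finset (Fin m), T.Nonempty → ¬ IsSquare (∏ j ∈ T, α j)) ∧
        e' ≠ 0 ∧ ∏ i, (q i : ℚ) ^ e i = ∏ j, α j ^ e' j ∧
        (∏ j, Height.logHeight₁ (α j)) ≤ (m : ℝ) ^ (2 * m) * p * ∏ i, Real.log (q i) ∧
        (∀ j, (|e' j| : ℝ) ≤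
          (m : ℝ) ^ (2 * m) * p * (∏ i, Real.log (q i)) * (Finset.univ.sup fun i => (e i).natAbs)) ∧
        (∀ j, Real.log p ≤ 2 * Height.logHeight₁ (α j)))
    {C : ℕ → ℝ} {r : ℕ → ℕ} {c₁ c₂ : ℝ} (hc₁ : 1 ≤ c₁) (hc₂ : c₂ ≤ 1)
    (hC : ∀ m, 0 ≤ C m ∧ C m ≤ c₁ ^ m * (m : ℝ) ^ (c₂ * m))
    (hA : ∀ (p : ℕ), p.Prime → p ≠ 2 →
      ∀ (m : ℕ) (α : Fin m → ℚ) (b : Fin m → ℤ) (V : Fin m → ℝ) (Vmax W : ℝ),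
        (∀ j, α j ≠ 0 ∧ 1 ≤ padicValRat p (α j - 1)) →
        (∀ μ : Fin m → ℤ, ∏ j, α j ^ μ j = 1 → μ = 0) →
        (∀ T : Finset (Fin m), T.Nonempty → ¬ IsSquare (∏ j ∈ T, α j)) →
        (∀ j, Height.logHeight₁ (α j) ≤ V j) → (∀ j, Real.log p ≤ V j) → (∀ j, V j ≤ Vmax) →
        b ≠ 0 → (∀ j, Real.log (max 3 (|b j| : ℝ)) ≤ W) →
        (padicValRat p (∏ j, α j ^ b j - 1) : ℝ) * Real.log p ≤
          C m * (∏ j, V j) * (W + Real.log (2 * Vmax)) * Real.log (2 * Vmax) / Real.log p ^ r m) :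
    EpsShapeBoundThree := by
  rw [epsShapeBoundThree_iff]
  refine epsShapeBound_mono ?_ (epsShapeBound_of_principal_core hM hc₁ hC hA)
  exact max_le (by norm_num) (by linarith)

end KappaDoor

end Summit.ABC.StewartYu

end
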